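import Summits.BirchSwinnertonDyer.BirchSwinnertonDyer.Theorems.GenusKolyvaginAtTwoMinimalTwinBSDTwoDyadicOrdinary
import Summits.BirchSwinnertonDyer.BirchSwinnertonDyer.Theorems.AlignedTransportAtTwoMainConjectureTransportAlignedAtTwoKilfordStratumShared
import HarnessLib

/-!
# Route `GenusKolyvaginAtTwo`, crux U₂ `MinimalTwinBSDTwo` (stmt-BirchSwinnertonDyer-22985): the Kilford-stratum dictionary at `2` on the WHOLE
# good-at-`2` locus — «ON the stratum» ⟹ ordinary; «ON the stratum ⟺ Δ_min ≡ 1 (mod 8)» without an ordinary hypothesis; the U₂ CM-transfer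
# card's clean sub-cell is {good ORDINARY at 2} ∩ {ON the Kilford stratum} = {ρ̄_{W,2}(D₂) = 1}

Seat `bsd-line-gk2-p2` g30 (PROVER seat 2/3, cell `bsd-f1-sign2`, LINE 23 «twin_swap» holder), `--supports stmt-BirchSwinnertonDyer-22985` (helper;
closes nothing).  THEOREMS ONLY (no definition, no named fact, no `sorry`); standard axioms.  **BSD is NOT proved by this file; U₂ is NOT proved; no
item is closed.**  Sequel of `…MinimalTwinBSDTwoDyadicOrdinary` (p797430).

WHY (U₂ / cross-route currency).  The U₂ crux-idea card `Cruxes/MinimalTwinBSDTwo/Ideas/u2-mod2-dihedral-cm-transfer.md` lives on the «clean sub-cell»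
{`Δ_W < 0`, `ρ̄_{W,2}` onto, `2 ∤ N_W`, `2` split in `k_W = ℚ(√Δ_W)` (⟺ squarefree core of `Δ_W` `≡ 1 (mod 8)`), `C(W)` odd, Manin odd}.  On a minimal
equation good at `2`, `Δ_min` is odd, so «core `≡ 1 (mod 8)`» is «`Δ_min ≡ 1 (mod 8)`» (odd squares are `1 mod 8`).  Route `AlignedTransportAtTwo` (crux
C1) partitions the good-ORDINARY locus by the KILFORD STRATUM `F1Sign2.OnKilfordStratumAtTwo W` («the `u`-cubic splits over `ℚ₂`», i.e. `W[2] ⊆ W(ℚ₂)`,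
`ρ̄_{W,2}(D₂) = 1`) and proved, ON THE ORDINARY LOCUS, `OnKilfordStratumAtTwo W ↔ Δ_min ≡ 1 (mod 8)` (`…KilfordStratumShared`, att-p4).  With the
supersingular exclusion of p797430 (`2 ∣ a₂ ⟹` no `ℚ₂`-root) both hypotheses «ordinary» become CONCLUSIONS:

* §1 `isOrdinaryAt_two_of_onKilfordStratumAtTwo` — good at `2` and ON the stratum ⟹ ORDINARY (a split cubic has a `ℚ₂`-root);
  `not_onKilfordStratumAtTwo_of_two_dvd_frobeniusTrace_two` — good SUPERSINGULAR ⟹ OFF the stratum;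
  `isOrdinaryAt_two_of_minimalDiscriminantInt_emod_eight_ne_five` — good at `2` and `Δ_min ≢ 5 (mod 8)` ⟹ ordinary (tree `…emod_eight_eq_five_of_two_dvd_…`).
* §2 ★ `onKilfordStratumAtTwo_iff_minimalDiscriminantInt_emod_eight_of_hasGoodReduction` — for EVERY `W` with good reduction at `2` (ordinary or not):
  `OnKilfordStratumAtTwo W ↔ Δ_min(W) ≡ 1 (mod 8)`.
* §3 ★ `isOrdinaryAt_two_and_onKilfordStratumAtTwo_of_emod_eight_eq_one` — THE CARD'S CELL: `2 ∤ N_W` and `Δ_min ≡ 1 (mod 8)` («`2` split in `k_W`») ⟹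
  `W` is good ORDINARY at `2` AND ON the Kilford stratum (`W[2] ⊆ W(ℚ₂)`: `2` totally split in `ℚ(W[2])`, so in the cubic field `F` and in `k_W`; the
  card's extra clause «χ unramified above 2» is then automatic).  READING for the crit / planners: the card's clean sub-cell is EXACTLY the `Δ < 0` part
  of C1's declared residual «ON the stratum ∪ `Δ > 0`» = the complement of the Buzzard-multiplicity-one locus
  (`…KilfordStratumShared.buzzardLocus_iff_not_onKilfordStratumAtTwo_and_Δ_neg`): the congruence transport K2 of the card must work precisely where
  `ρ̄_{W,2}(Frob₂)` is trivial (Buzzard 2000 Prop. 2.4 / Kilford–Wiese: the non-Gorenstein stratum at `2`).  Nothing here proves or refutes K1–K3.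

References: [SilvermanAEC2009] III.1, VII.2, V.4 + Ex. 5.7; [Serre1972] §1.11; [Serre1973] Ch. II §3.3 Thm 4 (odd 2-adic squares ≡ 1 mod 8);
[Kilford2002], [KilfordWiese2008] Thm 1.2–1.3, [Buzzard2000LevelLoweringModTwo] Prop. 2.4 (cite-level, via `…KilfordStratum`).
-/

set_option autoImplicit false
set_option linter.dupNamespace false -- `Summit.<P>.<Sub>` repeats `BirchSwinnertonDyer` (D-0017)

noncomputable section

open scoped Classical

open Polynomial WeierstrassCurve NumberField
open Literature.NumberTheory.EllipticCurves Literature.NumberTheory.EllipticCurves.Greenberg1999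
open Summit.BirchSwinnertonDyer.Rank1Residual.F1Sign2
open Summit.BirchSwinnertonDyer.BirchSwinnertonDyer.Theorems.AlignedTransportAtTwoBridge
open Summit.BirchSwinnertonDyer.BirchSwinnertonDyer.Theorems.AlignedTransportAtTwoKilfordStratum
open Summit.BirchSwinnertonDyer.BirchSwinnertonDyer.Theorems.AlignedTransportAtTwoKilfordStratumShared

namespace Summit.BirchSwinnertonDyer.BirchSwinnertonDyer.Theorems.GenusExact.TwinSwap.DyadicOrdinary

variable (W : WeierstrassCurve ℚ) [W.IsElliptic] [W.IsGloballyMinimal]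

/-! ## §1 ON the stratum ⟹ ordinary; supersingular ⟹ OFF the stratum -/

/-- **Good at `2` and ON the Kilford stratum ⟹ good ORDINARY at `2`.**  A split cubic has a root in `ℚ₂`; by p797430's
`isOrdinaryAt_two_iff_exists_padic_root` a `ℚ₂`-root of `c_W` at a good prime `2` means ordinary. [cite: Serre1972, §1.11] [cite: SilvermanAEC2009, V.4, VII.2] -/
theorem isOrdinaryAt_two_of_onKilfordStratumAtTwo (hgood : W.HasGoodReductionAtPrime 2) (hK : OnKilfordStratumAtTwo W) :
    IsOrdinaryAt W 2 := by
  have hdeg : ((twoDivisionUCubic W).map (algebraMap ℚ ℚ_[2])).degree ≠ 0 := by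
    rw [degree_map, degree_eq_natDegree (monic_twoDivisionUCubic W).ne_zero, natDegree_twoDivisionUCubic]
    norm_num
  obtain ⟨y, hy⟩ := Splits.exists_eval_eq_zero hK hdeg
  exact (isOrdinaryAt_two_iff_exists_padic_root W hgood).mpr ⟨y, by rwa [aeval_def, eval₂_eq_eval_map]⟩

/-- **Good SUPERSINGULAR at `2` ⟹ OFF the Kilford stratum** (`2 ∣ a₂(W)`; no root of `c_W` in `ℚ₂`, let alone three). [cite: Serre1972, §1.11] -/
theorem not_onKilfordStratumAtTwo_of_two_dvd_frobeniusTrace_two (hgood : W.HasGoodReductionAtPrime 2)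
    (hss : (2 : ℤ) ∣ W.frobeniusTrace 2) : ¬ OnKilfordStratumAtTwo W :=
  fun hK ↦ (isOrdinaryAt_two_of_onKilfordStratumAtTwo W hgood hK).2 (by exact_mod_cast hss)

/-- **Good at `2` and `Δ_min ≢ 5 (mod 8)` ⟹ good ORDINARY at `2`** (contrapositive of the tree's
`minimalDiscriminantInt_emod_eight_eq_five_of_two_dvd_frobeniusTrace_two`: supersingular ⟹ `Δ_min ≡ 5 (mod 8)`).  In particular «`2` split in
`k_W = ℚ(√Δ_W)`» (`Δ_min ≡ 1 (mod 8)`) or «`2` ramified in `k_W`» (`Δ_min ≡ 3 (mod 4)`) each force ordinary. [cite: Serre1972, §1.11] -/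
theorem isOrdinaryAt_two_of_minimalDiscriminantInt_emod_eight_ne_five (hgood : W.HasGoodReductionAtPrime 2)
    (h5 : minimalDiscriminantInt W % 8 ≠ 5) : IsOrdinaryAt W 2 := by
  refine ⟨hgood, fun hss ↦ h5 ?_⟩
  exact minimalDiscriminantInt_emod_eight_eq_five_of_two_dvd_frobeniusTrace_two W hgood (by exact_mod_cast hss)

/-! ## §2 The stratum dictionary on the whole good-at-`2` locus -/

/-- ★ **For every `W/ℚ` (globally minimal) with GOOD reduction at `2`: `W` is ON the Kilford stratum ⟺ `Δ_min(W) ≡ 1 (mod 8)`** — att-p4's dictionary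
`…KilfordStratumShared.onKilfordStratumAtTwo_iff_minimalDiscriminantInt_emod_eight` with its ORDINARY hypothesis removed (ON ⟹ ordinary by §1;
`Δ_min ≡ 1 (mod 8)` ⟹ ordinary by §1). [cite: Serre1973, Ch. II §3.3 Thm 4] [cite: Serre1972, §1.11] -/
theorem onKilfordStratumAtTwo_iff_minimalDiscriminantInt_emod_eight_of_hasGoodReduction (hgood : W.HasGoodReductionAtPrime 2) :
    OnKilfordStratumAtTwo W ↔ minimalDiscriminantInt W % 8 = 1 := by
  constructor
  · intro hK
    exact (onKilfordStratumAtTwo_iff_minimalDiscriminantInt_emod_eight W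
      (isOrdinaryAt_two_of_onKilfordStratumAtTwo W hgood hK)).mp hK
  · intro h1
    exact (onKilfordStratumAtTwo_iff_minimalDiscriminantInt_emod_eight W
      (isOrdinaryAt_two_of_minimalDiscriminantInt_emod_eight_ne_five W hgood (by rw [h1]; norm_num))).mpr h1

/-- The negated form on the good-at-`2` locus: OFF the stratum ⟺ `Δ_min % 8 ≠ 1` (⟺ `Δ_min ≡ 3, 5, 7 (mod 8)`; the supersingular curves are all
in the class `5`). [cite: Serre1973, Ch. II §3.3 Thm 4] -/
theorem not_onKilfordStratumAtTwo_iff_minimalDiscriminantInt_emod_eight_ne_of_hasGoodReduction (hgood : W.HasGoodReductionAtPrime 2) :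
    ¬ OnKilfordStratumAtTwo W ↔ minimalDiscriminantInt W % 8 ≠ 1 :=
  (onKilfordStratumAtTwo_iff_minimalDiscriminantInt_emod_eight_of_hasGoodReduction W hgood).not

/-! ## §3 The U₂ CM-transfer card's clean sub-cell -/

/-- ★ **THE CARD'S CELL AT `2`.**  `W/ℚ` globally minimal with GOOD reduction at `2` and `Δ_min ≡ 1 (mod 8)` — i.e. `2 ∤ N_W` and `2` SPLIT in
`k_W = ℚ(√Δ_W)` (the card's «squarefree core of `Δ_W` `≡ 1 (mod 8)`»: `Δ_min` is odd and odd squares are `≡ 1 (mod 8)`).  Then `W` is good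
ORDINARY at `2` (`a₂(W)` odd — the card's prediction, unconditionally) AND ON the Kilford stratum: the `2`-division cubic splits completely over `ℚ₂`,
`W[2] ⊆ W(ℚ₂)`, `ρ̄_{W,2}(D₂) = 1` — so `2` is totally split in `ℚ(W[2])`, in the cubic `2`-division field and in `k_W`, and the card's clause
«χ unramified above 2» holds automatically.  Equivalently: inside `Δ_W < 0` the card's cell is the complement of C1's Buzzard locus
(`…KilfordStratumShared.buzzardLocus_iff_not_onKilfordStratumAtTwo_and_Δ_neg`).  Nothing about BSD, U₂ or the card's cruxes K1–K3 is proved.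
[cite: Serre1972, §1.11] [cite: Serre1973, Ch. II §3.3 Thm 4] [cite: SilvermanAEC2009, VII.2] -/
theorem isOrdinaryAt_two_and_onKilfordStratumAtTwo_of_emod_eight_eq_one (hgood : W.HasGoodReductionAtPrime 2)
    (h1 : minimalDiscriminantInt W % 8 = 1) : IsOrdinaryAt W 2 ∧ OnKilfordStratumAtTwo W :=
  ⟨isOrdinaryAt_two_of_minimalDiscriminantInt_emod_eight_ne_five W hgood (by rw [h1]; norm_num),
    (onKilfordStratumAtTwo_iff_minimalDiscriminantInt_emod_eight_of_hasGoodReduction W hgood).mpr h1⟩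

/-- On the card's cell the `2`-torsion is `ℚ₂`-rational: every root of the `u`-cubic lies in `ℚ₂` — three `ℚ₂`-roots counted with multiplicity, i.e.
`(c_W.map ℚ₂).roots` has cardinality `3`. [cite: SilvermanAEC2009, III.2.3, VII.2] -/
theorem card_roots_map_padic_eq_three_of_emod_eight_eq_one (hgood : W.HasGoodReductionAtPrime 2)
    (h1 : minimalDiscriminantInt W % 8 = 1) :
    Multiset.card ((twoDivisionUCubic W).map (algebraMap ℚ ℚ_[2])).roots = 3 := by
  have hK := (isOrdinaryAt_two_and_onKilfordStratumAtTwo_of_emod_eight_eq_one W hgood h1).2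
  rw [← hK.natDegree_eq_card_roots, natDegree_map, natDegree_twoDivisionUCubic]

end Summit.BirchSwinnertonDyer.BirchSwinnertonDyer.Theorems.GenusExact.TwinSwap.DyadicOrdinary

end
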